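import Literature.NumberTheory.LFunctions.LevinsonConreyShortMollifiers
import Mathlib.MeasureTheory.Integral.IntervalIntegral.FundThmCalculus
import Mathlib.Analysis.SpecialFunctions.Trigonometric.ArctanDeriv
import Mathlib.Analysis.Calculus.Deriv.MeanValue
import Mathlib.Analysis.Complex.ExponentialBounds
import Mathlib.Analysis.Real.Pi.Bounds
import HarnessLib

/-!
# Conrey–Farmer–Kwan–Lin–Turnage-Butterbaugh 2025, Theorem 1 — PROOF file (theorems only)

Discharge of the named fact `cfklt2025_shortMollifiers_theorem1` (decl of record,
`LevinsonShortMollifierProportion.lean`) and, through the proved alias bridge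
`conreyFarmerKwanLinTurnageButterbaugh2025_theorem1_of_record`, of
`conreyFarmerKwanLinTurnageButterbaugh2025_theorem1` (`LevinsonConreyShortMollifiers.lean`):
there is `θ₀ > 0` (here `θ₀ = 1/8`) such that for every `0 < θ < θ₀` there are `R > 0` and an
admissible detector `Q` with `κ = 1 − log c(P,Q,R)/R > 2θ/3` for Levinson's `P(x) = x`.

PROOF ROAD (not the printed one). The paper [ConreyFarmerKwanLinTurnageButterbaugh2025, §§3–5]
fixes `R = √(3/5)/θ` (its Assumption 1) and solves the Euler–Lagrange equation by `₂F₁`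
hypergeometric functions with Mathematica-evaluated constants. Here instead: `R = 1/θ` and the
LOGISTIC detector `Q(y) = (1/(1+e^{3R(y−½)}) − ε)/τ`, `ε = 1/(1+e^{3R/2})`, `τ = 1 − 2ε`
(so `Q(0) = 1`, `Q(y) + Q(1−y) = 1` exactly, `Q ∈ C^∞`). After the inner `x`-integral and the
substitution `u = e^{R(y−½)}` the main part of the `y`-integrand is `(e^R/τ²)·u·f(u)` with
`f(u) = u(u⁶ − u³ + 7)/(3(1+u³)⁴) > 0`, which has the elementary antiderivative
`F(u) = (11u⁸+28u⁵+26u²)/(27(1+u³)³) − (11/81)log(1+u) + (11/162)log(u²−u+1)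
        + (11√3/81)·arctan((2u−1)/√3)`,
`∫₀^∞ f = F(∞) − F(0) = 11√3π/162 + 11√3π/486 = 22√3π/243 = 0.4926…`; the `ε`-terms are tiny.
Hence `c ≤ 1 + (e^R/τ²)·22√3π/243 + R·(e^R/τ²)(5ε + (7/3)ε²e^R) < e^{R−2/3}` for `R ≥ 8`, i.e.
`log c < R − 2/3`, i.e. `κ > 2/(3R) = 2θ/3`. (Float sanity check, not load-bearing:
`κ/θ → −log(22√3π/243) = 0.708…`, above the printed `2/3`, because `R` is re-tuned.)

All trial data are written as EXPLICIT terms (no new definitions); no named facts; no proof placeholders.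
«The programme SEARCHES and TYPES; no claim about Landau–Siegel zeros, Theorems 1–2 of
arXiv:2211.02515 or a repaired Margin232 until a kernel theorem says so.»

## References
* [ConreyFarmerKwanLinTurnageButterbaugh2025] J. B. Conrey, D. W. Farmer, C.-H. Kwan, Y. Lin,
  C. L. Turnage-Butterbaugh, *Short mollifiers of the Riemann zeta-function*, arXiv:2508.11108,
  Theorem 1 and §2.1–§2.2 (the functional `c(P,Q,R)`, the admissible class (2.6)).
-/

noncomputable section

open Real Set Filter Topology

namespace Literature.NumberTheory.LFunctions

namespace ShortMollifiers

namespace CFKLTProof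

/-! ### The logistic trial detector `Q(y) = (L_R(y) − ε)/τ`, `L_R(y) = 1/(1+e^{3R(y−½)})` -/

/-- `ε = 1/(1+e^{3R/2}) > 0`. [cite: ConreyFarmerKwanLinTurnageButterbaugh2025, Theorem 1 (step of this file's proof; §2.1–§2.2 for c(P,Q,R))] -/
theorem eps_pos (R : ℝ) : 0 < (1 / (1 + Real.exp (3 * R / 2))) := by positivity

/-- `ε < 1/2` for `R > 0`. [cite: ConreyFarmerKwanLinTurnageButterbaugh2025, Theorem 1 (step of this file's proof; §2.1–§2.2 for c(P,Q,R))] -/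
theorem eps_lt_half {R : ℝ} (hR : 0 < R) : (1 / (1 + Real.exp (3 * R / 2))) < 1 / 2 := by
  have h1 : 1 < Real.exp (3 * R / 2) := Real.one_lt_exp_iff.2 (by positivity)
  rw [div_lt_div_iff₀ (by positivity) (by norm_num)]
  linarith

/-- `τ = 1 − 2ε > 0` for `R > 0`. [cite: ConreyFarmerKwanLinTurnageButterbaugh2025, Theorem 1 (step of this file's proof; §2.1–§2.2 for c(P,Q,R))] -/
theorem tau_pos {R : ℝ} (hR : 0 < R) : 0 < (1 - 2 * (1 / (1 + Real.exp (3 * R / 2)))) := by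
  linarith [eps_lt_half hR]

/-- The logistic profile is positive. [cite: ConreyFarmerKwanLinTurnageButterbaugh2025, Theorem 1 (step of this file's proof; §2.1–§2.2 for c(P,Q,R))] -/
theorem logistic_pos (R y : ℝ) : 0 < (1 / (1 + Real.exp (3 * R * (y - 1 / 2)))) := by positivity

/-- `L_R(0) = 1 − ε`. [cite: ConreyFarmerKwanLinTurnageButterbaugh2025, Theorem 1 (step of this file's proof; §2.1–§2.2 for c(P,Q,R))] -/
theorem logistic_zero (R : ℝ) : (1 / (1 + Real.exp (3 * R * (0 - 1 / 2)))) = 1 - (1 / (1 + Real.exp (3 * R / 2))) := by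
  have h : 3 * R * (0 - 1 / 2) = -(3 * R / 2) := by ring
  rw [h, Real.exp_neg]
  have hE : 0 < Real.exp (3 * R / 2) := Real.exp_pos _
  field_simp
  ring

/-- `L_R(1−y) = 1 − L_R(y)` (logistic symmetry). [cite: ConreyFarmerKwanLinTurnageButterbaugh2025, Theorem 1 (step of this file's proof; §2.1–§2.2 for c(P,Q,R))] -/
theorem logistic_symm (R y : ℝ) : (1 / (1 + Real.exp (3 * R * ((1 - y) - 1 / 2)))) = 1 - (1 / (1 + Real.exp (3 * R * (y - 1 / 2)))) := by
  have h : 3 * R * (1 - y - 1 / 2) = -(3 * R * (y - 1 / 2)) := by ring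
  rw [h, Real.exp_neg]
  have hE : 0 < Real.exp (3 * R * (y - 1 / 2)) := Real.exp_pos _
  field_simp
  ring

/-- The logistic detector is admissible in the sense of (2.6): `C¹`, `Q(0) = 1`,
`Q(y) + Q(1−y) = 1` on `[0,1]` (in fact everywhere).
[cite: ConreyFarmerKwanLinTurnageButterbaugh2025, §2.1 (2.6)] -/
theorem isAdmissibleQ_logistic {R : ℝ} (hR : 0 < R) : IsAdmissibleQ (fun y : ℝ => ((1 / (1 + Real.exp (3 * R * (y - 1 / 2)))) - (1 / (1 + Real.exp (3 * R / 2)))) / (1 - 2 * (1 / (1 + Real.exp (3 * R / 2))))) := by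
  have hτ : (1 - 2 * (1 / (1 + Real.exp (3 * R / 2)))) ≠ 0 := (tau_pos hR).ne'
  refine ⟨?_, ?_, ?_⟩
  · apply ContDiff.div_const
    apply ContDiff.sub _ contDiff_const
    apply ContDiff.div contDiff_const
    · exact contDiff_const.add (ContDiff.exp (by fun_prop))
    · intro y; positivity
  · show ((1 / (1 + Real.exp (3 * R * (0 - 1 / 2)))) - (1 / (1 + Real.exp (3 * R / 2)))) / (1 - 2 * (1 / (1 + Real.exp (3 * R / 2)))) = 1
    rw [logistic_zero R]
    rw [show (1 - (1 / (1 + Real.exp (3 * R / 2))) - (1 / (1 + Real.exp (3 * R / 2)))) = (1 - 2 * (1 / (1 + Real.exp (3 * R / 2)))) by ring]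
    exact div_self hτ
  · intro y _
    show ((1 / (1 + Real.exp (3 * R * (y - 1 / 2)))) - (1 / (1 + Real.exp (3 * R / 2)))) / (1 - 2 * (1 / (1 + Real.exp (3 * R / 2)))) + ((1 / (1 + Real.exp (3 * R * ((1 - y) - 1 / 2)))) - (1 / (1 + Real.exp (3 * R / 2)))) / (1 - 2 * (1 / (1 + Real.exp (3 * R / 2)))) = 1
    rw [logistic_symm R y, ← add_div]
    rw [show (1 / (1 + Real.exp (3 * R * (y - 1 / 2)))) - (1 / (1 + Real.exp (3 * R / 2))) + (1 - (1 / (1 + Real.exp (3 * R * (y - 1 / 2)))) - (1 / (1 + Real.exp (3 * R / 2)))) = (1 - 2 * (1 / (1 + Real.exp (3 * R / 2)))) by ring]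
    exact div_self hτ

/-! ### Derivatives of the trial data -/

/-- Derivative of the logistic profile. [cite: ConreyFarmerKwanLinTurnageButterbaugh2025, Theorem 1 (step of this file's proof; §2.1–§2.2 for c(P,Q,R))] -/
theorem hasDerivAt_logistic (R y : ℝ) :
    HasDerivAt (fun y : ℝ => (1 / (1 + Real.exp (3 * R * (y - 1 / 2))))) (-(Real.exp (3 * R * (y - 1 / 2)) * (3 * R)) / (1 + Real.exp (3 * R * (y - 1 / 2))) ^ 2) y := by
  have h1 : HasDerivAt (fun y : ℝ => 3 * R * (y - 1 / 2)) (3 * R * 1) y :=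
    ((hasDerivAt_id' y).sub_const (1 / 2)).const_mul (3 * R)
  have hg : HasDerivAt (fun y : ℝ => 1 + Real.exp (3 * R * (y - 1 / 2)))
      (Real.exp (3 * R * (y - 1 / 2)) * (3 * R * 1)) y := h1.exp.const_add 1
  have hne : (1 + Real.exp (3 * R * (y - 1 / 2))) ≠ 0 := by positivity
  have hinv : HasDerivAt (fun y : ℝ => (1 + Real.exp (3 * R * (y - 1 / 2)))⁻¹)
      (-(Real.exp (3 * R * (y - 1 / 2)) * (3 * R * 1)) / (1 + Real.exp (3 * R * (y - 1 / 2))) ^ 2) y :=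
    hg.inv hne
  have heq : (fun y : ℝ => (1 / (1 + Real.exp (3 * R * (y - 1 / 2))))) = fun y => (1 + Real.exp (3 * R * (y - 1 / 2)))⁻¹ := by
    funext y; simp [one_div]
  rw [heq]
  exact hinv.congr_deriv (by ring)

/-- Derivative of the detector `Q = (L_R − ε)/τ`. [cite: ConreyFarmerKwanLinTurnageButterbaugh2025, Theorem 1 (step of this file's proof; §2.1–§2.2 for c(P,Q,R))] -/
theorem hasDerivAt_Q (R ε τ y : ℝ) :
    HasDerivAt (fun y : ℝ => ((1 / (1 + Real.exp (3 * R * (y - 1 / 2)))) - ε) / τ) ((-(Real.exp (3 * R * (y - 1 / 2)) * (3 * R)) / (1 + Real.exp (3 * R * (y - 1 / 2))) ^ 2) / τ) y :=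
  ((hasDerivAt_logistic R y).sub_const _).div_const _

/-- `w′(y)` for `w(y) = e^{Ry}Q(y)`. [cite: ConreyFarmerKwanLinTurnageButterbaugh2025, §2.1 (w = e^{Ry}Q)] -/
theorem hasDerivAt_w (R ε τ y : ℝ) :
    HasDerivAt (fun u : ℝ => Real.exp (R * u) * (((1 / (1 + Real.exp (3 * R * (u - 1 / 2)))) - ε) / τ)) (Real.exp (R * y) * R * (((1 / (1 + Real.exp (3 * R * (y - 1 / 2)))) - ε) / τ) + Real.exp (R * y) * ((-(Real.exp (3 * R * (y - 1 / 2)) * (3 * R)) / (1 + Real.exp (3 * R * (y - 1 / 2))) ^ 2) / τ)) y := by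
  have h0 : HasDerivAt (fun u : ℝ => R * u) (R * 1) y := (hasDerivAt_id' y).const_mul R
  have h1 : HasDerivAt (fun u : ℝ => Real.exp (R * u)) (Real.exp (R * y) * (R * 1)) y := h0.exp
  exact (h1.mul (hasDerivAt_Q R ε τ y)).congr_deriv (by ring)

/-! ### The inner `x`-integral -/

/-- `∫₀¹ (A + Cx)² dx = A² + AC + C²/3` (the inner `x`-integral for `P(x) = x`). [cite: ConreyFarmerKwanLinTurnageButterbaugh2025, Theorem 1 (step of this file's proof; §2.1–§2.2 for c(P,Q,R))] -/
theorem integral_sq_affine (A C : ℝ) :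
    ∫ x in (0 : ℝ)..1, (A * 1 + C * x) ^ 2 = A ^ 2 + A * C + C ^ 2 / 3 := by
  have hderiv : ∀ x ∈ uIcc (0 : ℝ) 1,
      HasDerivAt (fun x => A ^ 2 * x + A * C * x ^ 2 + C ^ 2 / 3 * x ^ 3) ((A * 1 + C * x) ^ 2) x := by
    intro x _
    have h : HasDerivAt (fun x => A ^ 2 * x + A * C * x ^ 2 + C ^ 2 / 3 * x ^ 3)
        (A ^ 2 * 1 + A * C * (↑(2 : ℕ) * x ^ (2 - 1)) + C ^ 2 / 3 * (↑(3 : ℕ) * x ^ (3 - 1))) x :=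
      (((hasDerivAt_id' x).const_mul (A ^ 2)).add
        ((hasDerivAt_pow 2 x).const_mul (A * C))).add ((hasDerivAt_pow 3 x).const_mul (C ^ 2 / 3))
    refine h.congr_deriv ?_
    push_cast
    ring
  rw [intervalIntegral.integral_eq_sub_of_hasDerivAt hderiv
    ((by fun_prop : Continuous fun x : ℝ => (A * 1 + C * x) ^ 2).intervalIntegrable _ _)]
  ring

/-! ### The function `f` and its elementary antiderivative `F` -/

/-- `f(u) = u(u⁶−u³+7)/(3(1+u³)⁴) ≥ 0` for `u ≥ 0`. [cite: ConreyFarmerKwanLinTurnageButterbaugh2025, Theorem 1 (step of this file's proof; §2.1–§2.2 for c(P,Q,R))] -/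
theorem fInt_nonneg {u : ℝ} (hu : 0 ≤ u) : 0 ≤ (u * (u ^ 6 - u ^ 3 + 7) / (3 * (1 + u ^ 3) ^ 4)) := by
  have h1 : 0 < u ^ 6 - u ^ 3 + 7 := by nlinarith [sq_nonneg (u ^ 3 - 1 / 2)]
  have h2 : 0 < 1 + u ^ 3 := by positivity
  exact div_nonneg (mul_nonneg hu h1.le) (by positivity)

/-- `u² − u + 1 > 0`. [cite: ConreyFarmerKwanLinTurnageButterbaugh2025, Theorem 1 (step of this file's proof; §2.1–§2.2 for c(P,Q,R))] -/
theorem quad_pos (u : ℝ) : 0 < u ^ 2 - u + 1 := by nlinarith [sq_nonneg (u - 1 / 2)]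

/-- The arctan part of `F′`: `(11√3/81)·d/du arctan((2u−1)/√3) = 11/(54(u²−u+1))`. [cite: ConreyFarmerKwanLinTurnageButterbaugh2025, Theorem 1 (step of this file's proof; §2.1–§2.2 for c(P,Q,R))] -/
theorem arctan_term_eq (u : ℝ) :
    11 * Real.sqrt 3 / 81 * (1 / (1 + ((2 * u - 1) / Real.sqrt 3) ^ 2) * (2 * 1 / Real.sqrt 3)) =
      11 / (54 * (u ^ 2 - u + 1)) := by
  have hs : Real.sqrt 3 ≠ 0 := by positivity
  have h3 : Real.sqrt 3 ^ 2 = 3 := Real.sq_sqrt (by norm_num)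
  have hq : u ^ 2 - u + 1 ≠ 0 := (quad_pos u).ne'
  have hq2 : u * (u - 1) + 1 ≠ 0 := by nlinarith [sq_nonneg (u - 1 / 2)]
  have e1 : 1 + (2 * u - 1) ^ 2 / 3 = 4 * (u ^ 2 - u + 1) / 3 := by ring
  rw [div_pow, h3, e1, one_div_div]
  rw [eq_div_iff (by positivity : (54 * (u ^ 2 - u + 1)) ≠ 0)]
  field_simp
  ring

/-- Derivative of the rational part of `F`. [cite: ConreyFarmerKwanLinTurnageButterbaugh2025, Theorem 1 (step of this file's proof; §2.1–§2.2 for c(P,Q,R))] -/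
theorem hasDerivAt_ratPart (u : ℝ) (hu : -1 < u) :
    HasDerivAt (fun u : ℝ => (11 * u ^ 8 + 28 * u ^ 5 + 26 * u ^ 2) / (27 * (1 + u ^ 3) ^ 3))
      ((-11 * u ^ 10 - 24 * u ^ 7 - 42 * u ^ 4 + 52 * u) / (27 * (1 + u ^ 3) ^ 4)) u := by
  have hcube : 0 < 1 + u ^ 3 := by nlinarith [sq_nonneg u, sq_nonneg (u + 1), sq_nonneg (u - 1)]
  have hN : HasDerivAt (fun u : ℝ => 11 * u ^ 8 + 28 * u ^ 5 + 26 * u ^ 2)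
      (11 * (↑(8 : ℕ) * u ^ (8 - 1)) + 28 * (↑(5 : ℕ) * u ^ (5 - 1)) + 26 * (↑(2 : ℕ) * u ^ (2 - 1))) u :=
    (((hasDerivAt_pow 8 u).const_mul 11).add ((hasDerivAt_pow 5 u).const_mul 28)).add
      ((hasDerivAt_pow 2 u).const_mul 26)
  have hD : HasDerivAt (fun u : ℝ => 27 * (1 + u ^ 3) ^ 3)
      (27 * (↑(3 : ℕ) * (1 + u ^ 3) ^ (3 - 1) * (↑(3 : ℕ) * u ^ (3 - 1)))) u :=
    (((hasDerivAt_pow 3 u).const_add 1).pow 3).const_mul 27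
  have hDne : (27 * (1 + u ^ 3) ^ 3) ≠ 0 := by positivity
  refine (hN.div hD hDne).congr_deriv ?_
  push_cast
  field_simp
  ring

/-- `F′ = f` on `(−1, ∞)`. [cite: ConreyFarmerKwanLinTurnageButterbaugh2025, §2.2 (J reduced to one variable)] -/
theorem hasDerivAt_F (u : ℝ) (hu : -1 < u) :
    HasDerivAt (fun u : ℝ => ((11 * u ^ 8 + 28 * u ^ 5 + 26 * u ^ 2) / (27 * (1 + u ^ 3) ^ 3) - 11 / 81 * Real.log (1 + u) + 11 / 162 * Real.log (u ^ 2 - u + 1) + 11 * Real.sqrt 3 / 81 * Real.arctan ((2 * u - 1) / Real.sqrt 3))) (u * (u ^ 6 - u ^ 3 + 7) / (3 * (1 + u ^ 3) ^ 4)) u := by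
  have h1u : 0 < 1 + u := by linarith
  have hq := quad_pos u
  have hcube : 0 < 1 + u ^ 3 := by
    have : 1 + u ^ 3 = (1 + u) * (u ^ 2 - u + 1) := by ring
    rw [this]; positivity
  have hr := hasDerivAt_ratPart u hu
  have hl1 : HasDerivAt (fun u : ℝ => Real.log (1 + u)) (1 / (1 + u)) u :=
    ((hasDerivAt_id' u).const_add 1).log h1u.ne'
  have hl2 : HasDerivAt (fun u : ℝ => Real.log (u ^ 2 - u + 1))
      ((↑(2 : ℕ) * u ^ (2 - 1) - 1) / (u ^ 2 - u + 1)) u :=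
    (((hasDerivAt_pow 2 u).sub (hasDerivAt_id' u)).add_const 1).log hq.ne'
  have hg : HasDerivAt (fun u : ℝ => (2 * u - 1) / Real.sqrt 3) (2 * 1 / Real.sqrt 3) u :=
    (((hasDerivAt_id' u).const_mul 2).sub_const 1).div_const _
  have ha : HasDerivAt (fun u : ℝ => Real.arctan ((2 * u - 1) / Real.sqrt 3))
      (1 / (1 + ((2 * u - 1) / Real.sqrt 3) ^ 2) * (2 * 1 / Real.sqrt 3)) u := hg.arctan
  have hsum : HasDerivAt (fun u : ℝ => ((11 * u ^ 8 + 28 * u ^ 5 + 26 * u ^ 2) / (27 * (1 + u ^ 3) ^ 3) - 11 / 81 * Real.log (1 + u) + 11 / 162 * Real.log (u ^ 2 - u + 1) + 11 * Real.sqrt 3 / 81 * Real.arctan ((2 * u - 1) / Real.sqrt 3)))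
      ((-11 * u ^ 10 - 24 * u ^ 7 - 42 * u ^ 4 + 52 * u) / (27 * (1 + u ^ 3) ^ 4)
        - 11 / 81 * (1 / (1 + u)) + 11 / 162 * ((↑(2 : ℕ) * u ^ (2 - 1) - 1) / (u ^ 2 - u + 1))
        + 11 * Real.sqrt 3 / 81 * (1 / (1 + ((2 * u - 1) / Real.sqrt 3) ^ 2) * (2 * 1 / Real.sqrt 3))) u :=
    ((hr.sub (hl1.const_mul (11 / 81))).add (hl2.const_mul (11 / 162))).add
      (ha.const_mul (11 * Real.sqrt 3 / 81))
  refine hsum.congr_deriv ?_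
  rw [arctan_term_eq u]
  have hq' : u ^ 2 - u + 1 ≠ 0 := hq.ne'
  have hq2 : u * (u - 1) + 1 ≠ 0 := by nlinarith [sq_nonneg (u - 1 / 2)]
  have h1u' : 1 + u ≠ 0 := h1u.ne'
  have hc' : 1 + u ^ 3 ≠ 0 := hcube.ne'
  push_cast
  field_simp
  ring

/-- `F` is continuous on `[0, ∞)`. [cite: ConreyFarmerKwanLinTurnageButterbaugh2025, Theorem 1 (step of this file's proof; §2.1–§2.2 for c(P,Q,R))] -/
theorem continuousOn_F : ContinuousOn (fun u : ℝ => ((11 * u ^ 8 + 28 * u ^ 5 + 26 * u ^ 2) / (27 * (1 + u ^ 3) ^ 3) - 11 / 81 * Real.log (1 + u) + 11 / 162 * Real.log (u ^ 2 - u + 1) + 11 * Real.sqrt 3 / 81 * Real.arctan ((2 * u - 1) / Real.sqrt 3))) (Ici 0) := fun u hu =>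
  (hasDerivAt_F u (by linarith [mem_Ici.1 hu])).continuousAt.continuousWithinAt

/-- `F` is monotone on `[0, ∞)` (`F′ = f ≥ 0`). [cite: ConreyFarmerKwanLinTurnageButterbaugh2025, Theorem 1 (step of this file's proof; §2.1–§2.2 for c(P,Q,R))] -/
theorem monotoneOn_F : MonotoneOn (fun u : ℝ => ((11 * u ^ 8 + 28 * u ^ 5 + 26 * u ^ 2) / (27 * (1 + u ^ 3) ^ 3) - 11 / 81 * Real.log (1 + u) + 11 / 162 * Real.log (u ^ 2 - u + 1) + 11 * Real.sqrt 3 / 81 * Real.arctan ((2 * u - 1) / Real.sqrt 3))) (Ici 0) := by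
  refine monotoneOn_of_deriv_nonneg (convex_Ici 0) continuousOn_F ?_ ?_
  · intro u hu
    rw [interior_Ici] at hu
    exact (hasDerivAt_F u (by linarith [mem_Ioi.1 hu])).differentiableAt.differentiableWithinAt
  · intro u hu
    rw [interior_Ici] at hu
    have hu0 : 0 < u := mem_Ioi.1 hu
    rw [(hasDerivAt_F u (by linarith)).deriv]
    exact fInt_nonneg hu0.le

/-- `F(0) = −11√3π/486`.
[cite: ConreyFarmerKwanLinTurnageButterbaugh2025, Theorem 1 (step of this file's proof; §2.1–§2.2 for c(P,Q,R))] -/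
theorem F_zero : ((11 * (0:ℝ) ^ 8 + 28 * (0:ℝ) ^ 5 + 26 * (0:ℝ) ^ 2) / (27 * (1 + (0:ℝ) ^ 3) ^ 3) - 11 / 81 * Real.log (1 + (0:ℝ)) + 11 / 162 * Real.log ((0:ℝ) ^ 2 - (0:ℝ) + 1) + 11 * Real.sqrt 3 / 81 * Real.arctan ((2 * (0:ℝ) - 1) / Real.sqrt 3)) = -(11 * Real.sqrt 3 * π / 486) := by
  have h : (2 * (0 : ℝ) - 1) / Real.sqrt 3 = -(Real.sqrt 3)⁻¹ := by ring
  rw [h, Real.arctan_neg, Real.arctan_inv_sqrt_three]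
  norm_num
  ring

/-! ### The limit of `F` at `+∞` -/

/-- The rational part of `F` tends to `0` at `+∞`. [cite: ConreyFarmerKwanLinTurnageButterbaugh2025, Theorem 1 (step of this file's proof; §2.1–§2.2 for c(P,Q,R))] -/
theorem tendsto_ratPart :
    Tendsto (fun u : ℝ => (11 * u ^ 8 + 28 * u ^ 5 + 26 * u ^ 2) / (27 * (1 + u ^ 3) ^ 3))
      atTop (𝓝 0) := by
  have hup : Tendsto (fun u : ℝ => (65 / 27) * u⁻¹) atTop (𝓝 0) := by
    simpa using tendsto_inv_atTop_zero.const_mul (65 / 27 : ℝ)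
  refine tendsto_of_tendsto_of_tendsto_of_le_of_le' tendsto_const_nhds hup ?_ ?_
  · filter_upwards [eventually_ge_atTop (0 : ℝ)] with u hu
    positivity
  · filter_upwards [eventually_ge_atTop (1 : ℝ)] with u hu
    have hu0 : 0 < u := by linarith
    have h5 : u ^ 5 ≤ u ^ 8 := pow_le_pow_right₀ hu (by norm_num)
    have h2 : u ^ 2 ≤ u ^ 8 := pow_le_pow_right₀ hu (by norm_num)
    have key : (11 * u ^ 8 + 28 * u ^ 5 + 26 * u ^ 2) * u ≤ 65 * (1 + u ^ 3) ^ 3 := by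
      have h9 : u ^ 8 * u = u ^ 9 := by ring
      nlinarith [pow_nonneg hu0.le 3, pow_nonneg hu0.le 6, pow_nonneg hu0.le 9]
    rw [div_le_iff₀ (by positivity)]
    have hrw : 65 / 27 * u⁻¹ * (27 * (1 + u ^ 3) ^ 3) = 65 * (1 + u ^ 3) ^ 3 / u := by
      field_simp
    rw [hrw, le_div_iff₀ hu0]
    exact key

/-- `log(u²−u+1) − 2 log(1+u) → 0` at `+∞`. [cite: ConreyFarmerKwanLinTurnageButterbaugh2025, Theorem 1 (step of this file's proof; §2.1–§2.2 for c(P,Q,R))] -/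
theorem tendsto_logPart :
    Tendsto (fun u : ℝ => Real.log (u ^ 2 - u + 1) - 2 * Real.log (1 + u)) atTop (𝓝 0) := by
  have hq : Tendsto (fun u : ℝ => (u ^ 2 - u + 1) / (1 + u) ^ 2) atTop (𝓝 1) := by
    have hinv : Tendsto (fun u : ℝ => u⁻¹) atTop (𝓝 0) := tendsto_inv_atTop_zero
    have h1 : Tendsto (fun u : ℝ => (1 - u⁻¹ + u⁻¹ ^ 2) / (u⁻¹ + 1) ^ 2) atTop (𝓝 1) := by
      have h : Tendsto (fun u : ℝ => (1 - u⁻¹ + u⁻¹ ^ 2) / (u⁻¹ + 1) ^ 2) atTop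
          (𝓝 (((1 : ℝ) - 0 + 0 ^ 2) / (0 + 1) ^ 2)) :=
        (((tendsto_const_nhds (x := (1 : ℝ))).sub hinv).add (hinv.pow 2)).div
          ((hinv.add (tendsto_const_nhds (x := (1 : ℝ)))).pow 2) (by norm_num)
      have e : ((1 : ℝ) - 0 + 0 ^ 2) / (0 + 1) ^ 2 = 1 := by norm_num
      rw [e] at h
      exact h
    refine h1.congr' ?_
    filter_upwards [eventually_gt_atTop (0 : ℝ)] with u hu
    have hu' : u ≠ 0 := hu.ne'
    field_simp
  have hlog : Tendsto (fun u : ℝ => Real.log ((u ^ 2 - u + 1) / (1 + u) ^ 2)) atTop (𝓝 0) := by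
    have h := (Real.continuousAt_log one_ne_zero).tendsto.comp hq
    rw [Real.log_one] at h
    exact h
  refine hlog.congr' ?_
  filter_upwards [eventually_gt_atTop (0 : ℝ)] with u hu
  rw [Real.log_div (quad_pos u).ne' (by positivity), Real.log_pow]
  push_cast
  ring

/-- `arctan((2u−1)/√3) → π/2` at `+∞`. [cite: ConreyFarmerKwanLinTurnageButterbaugh2025, Theorem 1 (step of this file's proof; §2.1–§2.2 for c(P,Q,R))] -/
theorem tendsto_arctanPart :
    Tendsto (fun u : ℝ => Real.arctan ((2 * u - 1) / Real.sqrt 3)) atTop (𝓝 (π / 2)) := by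
  have hs : 0 < Real.sqrt 3 := by positivity
  have hin : Tendsto (fun u : ℝ => (2 * u - 1) / Real.sqrt 3) atTop atTop := by
    refine tendsto_atTop_atTop.2 fun b => ⟨(b * Real.sqrt 3 + 1) / 2, fun u hu => ?_⟩
    rw [le_div_iff₀ hs]
    linarith
  exact (Real.tendsto_arctan_atTop.mono_right nhdsWithin_le_nhds).comp hin

/-- `F(u) → 11√3π/162` as `u → +∞`.
[cite: ConreyFarmerKwanLinTurnageButterbaugh2025, Theorem 1 (step of this file's proof; §2.1–§2.2 for c(P,Q,R))] -/
theorem tendsto_F : Tendsto (fun u : ℝ => ((11 * u ^ 8 + 28 * u ^ 5 + 26 * u ^ 2) / (27 * (1 + u ^ 3) ^ 3) - 11 / 81 * Real.log (1 + u) + 11 / 162 * Real.log (u ^ 2 - u + 1) + 11 * Real.sqrt 3 / 81 * Real.arctan ((2 * u - 1) / Real.sqrt 3))) atTop (𝓝 (11 * Real.sqrt 3 * π / 162)) := by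
  have h := (tendsto_ratPart.add (tendsto_logPart.const_mul (11 / 162))).add
    (tendsto_arctanPart.const_mul (11 * Real.sqrt 3 / 81))
  have hlim : (0 : ℝ) + 11 / 162 * 0 + 11 * Real.sqrt 3 / 81 * (π / 2) = 11 * Real.sqrt 3 * π / 162 := by
    ring
  rw [← hlim]
  refine h.congr' (Eventually.of_forall fun u => ?_)
  simp only []
  ring

/-- **The main real-variable input**: `∫_a^b f ≤ F(∞) − F(0) = 22√3π/243`, in the form
`F(b) − F(a) ≤ 22√3π/243` for `0 ≤ a ≤ b`. [cite: ConreyFarmerKwanLinTurnageButterbaugh2025, §2.2] -/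
theorem F_sub_le {a b : ℝ} (ha : 0 ≤ a) (hab : a ≤ b) :
    ((11 * b ^ 8 + 28 * b ^ 5 + 26 * b ^ 2) / (27 * (1 + b ^ 3) ^ 3) - 11 / 81 * Real.log (1 + b) + 11 / 162 * Real.log (b ^ 2 - b + 1) + 11 * Real.sqrt 3 / 81 * Real.arctan ((2 * b - 1) / Real.sqrt 3)) - ((11 * a ^ 8 + 28 * a ^ 5 + 26 * a ^ 2) / (27 * (1 + a ^ 3) ^ 3) - 11 / 81 * Real.log (1 + a) + 11 / 162 * Real.log (a ^ 2 - a + 1) + 11 * Real.sqrt 3 / 81 * Real.arctan ((2 * a - 1) / Real.sqrt 3)) ≤ (22 * Real.sqrt 3 * π / 243) := by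
  have hb : 0 ≤ b := ha.trans hab
  have hup : (fun u : ℝ => ((11 * u ^ 8 + 28 * u ^ 5 + 26 * u ^ 2) / (27 * (1 + u ^ 3) ^ 3) - 11 / 81 * Real.log (1 + u) + 11 / 162 * Real.log (u ^ 2 - u + 1) + 11 * Real.sqrt 3 / 81 * Real.arctan ((2 * u - 1) / Real.sqrt 3))) b ≤ 11 * Real.sqrt 3 * π / 162 := by
    refine ge_of_tendsto tendsto_F ?_
    filter_upwards [eventually_ge_atTop b] with t ht
    exact monotoneOn_F (mem_Ici.2 hb) (mem_Ici.2 (hb.trans ht)) ht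
  have hlow : (fun u : ℝ => ((11 * u ^ 8 + 28 * u ^ 5 + 26 * u ^ 2) / (27 * (1 + u ^ 3) ^ 3) - 11 / 81 * Real.log (1 + u) + 11 / 162 * Real.log (u ^ 2 - u + 1) + 11 * Real.sqrt 3 / 81 * Real.arctan ((2 * u - 1) / Real.sqrt 3))) 0 ≤ (fun u : ℝ => ((11 * u ^ 8 + 28 * u ^ 5 + 26 * u ^ 2) / (27 * (1 + u ^ 3) ^ 3) - 11 / 81 * Real.log (1 + u) + 11 / 162 * Real.log (u ^ 2 - u + 1) + 11 * Real.sqrt 3 / 81 * Real.arctan ((2 * u - 1) / Real.sqrt 3))) a :=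
    monotoneOn_F (mem_Ici.2 le_rfl) (mem_Ici.2 ha) ha
  simp only [] at hup hlow
  rw [F_zero] at hlow
  have hπ : 0 < Real.sqrt 3 * π := by positivity
  linarith

/-! ### The pointwise bound for the reduced `y`-integrand -/

/-- Pure algebra: the reduced integrand splits into the main part `s²/τ²·u f(u)` and an
`ε`-remainder.
[cite: ConreyFarmerKwanLinTurnageButterbaugh2025, Theorem 1 (step of this file's proof; §2.1–§2.2 for c(P,Q,R))] -/
theorem alg_identity (s u ε τ R : ℝ) (hτ : τ ≠ 0) (hR : R ≠ 0) (hc : 1 + u ^ 3 ≠ 0) :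
    (s * u * ((1 / (1 + u ^ 3) - ε) / τ)) ^ 2
      + (s * u * ((1 / (1 + u ^ 3) - ε) / τ)) *
          (R⁻¹ * (s * u * R * ((1 / (1 + u ^ 3) - ε) / τ) + s * u * ((-(u ^ 3 * (3 * R)) / (1 + u ^ 3) ^ 2) / τ)))
      + (R⁻¹ * (s * u * R * ((1 / (1 + u ^ 3) - ε) / τ) + s * u * ((-(u ^ 3 * (3 * R)) / (1 + u ^ 3) ^ 2) / τ))) ^ 2 / 3
    = s ^ 2 / τ ^ 2 * (u * (u * (u ^ 6 - u ^ 3 + 7) / (3 * (1 + u ^ 3) ^ 4)))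
      + s ^ 2 / τ ^ 2 * (7 / 3 * ε ^ 2 * u ^ 2 - 14 / 3 * ε * (u ^ 2 / (1 + u ^ 3)) + 5 * ε * (u ^ 5 / (1 + u ^ 3) ^ 2)) := by
  field_simp
  ring

/-- The `ε`-remainder is at most `5ε + (7/3)ε²s²` (`0 < u ≤ s`). [cite: ConreyFarmerKwanLinTurnageButterbaugh2025, Theorem 1 (step of this file's proof; §2.1–§2.2 for c(P,Q,R))] -/
theorem rem_le (s u ε : ℝ) (hε : 0 ≤ ε) (hu0 : 0 < u) (hus : u ≤ s) :
    7 / 3 * ε ^ 2 * u ^ 2 - 14 / 3 * ε * (u ^ 2 / (1 + u ^ 3)) + 5 * ε * (u ^ 5 / (1 + u ^ 3) ^ 2)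
      ≤ 5 * ε + 7 / 3 * ε ^ 2 * s ^ 2 := by
  have hc : 0 < 1 + u ^ 3 := by positivity
  have t1 : ε ^ 2 * u ^ 2 ≤ ε ^ 2 * s ^ 2 :=
    mul_le_mul_of_nonneg_left (pow_le_pow_left₀ hu0.le hus 2) (sq_nonneg ε)
  have t2 : 0 ≤ 14 / 3 * ε * (u ^ 2 / (1 + u ^ 3)) := by positivity
  have t3 : u ^ 5 / (1 + u ^ 3) ^ 2 ≤ 1 := by
    rw [div_le_one (by positivity)]
    rcases le_total u 1 with h | h
    · have : u ^ 5 ≤ 1 := pow_le_one₀ hu0.le h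
      nlinarith [pow_nonneg hu0.le 3]
    · have h56 : u ^ 5 ≤ u ^ 6 := pow_le_pow_right₀ h (by norm_num)
      nlinarith [pow_nonneg hu0.le 3]
  have t3' : 5 * ε * (u ^ 5 / (1 + u ^ 3) ^ 2) ≤ 5 * ε * 1 :=
    mul_le_mul_of_nonneg_left t3 (by positivity)
  linarith

/-- For `y ≤ 1`, `θ = R⁻¹`: `A² + A(θB) + (θB)²/3 ≤ (e^R/τ²)·u f(u) + (e^R/τ²)(5ε + (7/3)ε²e^R)`,
`u = e^{R(y−½)}`, where `A = e^{Ry}Q(y)`, `B = w′(y)`.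
[cite: ConreyFarmerKwanLinTurnageButterbaugh2025, §2.2] -/
theorem key_pointwise (R ε τ y : ℝ) (hR : 0 < R) (hε : 0 ≤ ε) (hτ : 0 < τ) (hy1 : y ≤ 1) :
    ((Real.exp (R * y) * (((1 / (1 + Real.exp (3 * R * (y - 1 / 2)))) - ε) / τ)) ^ 2 + (Real.exp (R * y) * (((1 / (1 + Real.exp (3 * R * (y - 1 / 2)))) - ε) / τ)) * (R⁻¹ * (Real.exp (R * y) * R * (((1 / (1 + Real.exp (3 * R * (y - 1 / 2)))) - ε) / τ) + Real.exp (R * y) * ((-(Real.exp (3 * R * (y - 1 / 2)) * (3 * R)) / (1 + Real.exp (3 * R * (y - 1 / 2))) ^ 2) / τ))) + (R⁻¹ * (Real.exp (R * y) * R * (((1 / (1 + Real.exp (3 * R * (y - 1 / 2)))) - ε) / τ) + Real.exp (R * y) * ((-(Real.exp (3 * R * (y - 1 / 2)) * (3 * R)) / (1 + Real.exp (3 * R * (y - 1 / 2))) ^ 2) / τ))) ^ 2 / 3) ≤ (Real.exp R / τ ^ 2 * ((Real.exp (R * (y - 1 / 2))) * ((Real.exp (R * (y - 1 / 2))) * ((Real.exp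 (R * (y - 1 / 2))) ^ 6 - (Real.exp (R * (y - 1 / 2))) ^ 3 + 7) / (3 * (1 + (Real.exp (R * (y - 1 / 2))) ^ 3) ^ 4))) + (Real.exp R / τ ^ 2 * (5 * ε + 7 / 3 * ε ^ 2 * Real.exp R))) := by
  have hg : Real.exp (3 * R * (y - 1 / 2)) = Real.exp (R * (y - 1 / 2)) ^ 3 := by
    rw [← Real.exp_nat_mul]; congr 1; push_cast; ring
  have hE : Real.exp (R * y) = Real.exp (R / 2) * Real.exp (R * (y - 1 / 2)) := by
    rw [← Real.exp_add]; congr 1; ring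
  have heR : Real.exp R = Real.exp (R / 2) ^ 2 := by
    rw [← Real.exp_nat_mul]; congr 1; push_cast; ring
  rw [hg, hE, heR]
  set u := Real.exp (R * (y - 1 / 2)) with hu
  set s := Real.exp (R / 2) with hs
  have hu0 : 0 < u := Real.exp_pos _
  have hs0 : 0 < s := Real.exp_pos _
  have hus : u ≤ s := by
    rw [hu, hs]; exact Real.exp_le_exp.2 (by nlinarith)
  have hc : 0 < 1 + u ^ 3 := by positivity
  have hId := alg_identity s u ε τ R hτ.ne' hR.ne' hc.ne'
  have hI := rem_le s u ε hε hu0 hus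
  have hpos : 0 ≤ s ^ 2 / τ ^ 2 := by positivity
  have hmul := mul_le_mul_of_nonneg_left hI hpos
  rw [hId]
  linarith

/-! ### Integrating the bound -/

/-- FTC for the majorant: `∫₀¹ [(e^R/τ²)·u f(u) + C] dy = (e^R/τ²)(F(e^{R/2}) − F(e^{−R/2}))/R + C`. [cite: ConreyFarmerKwanLinTurnageButterbaugh2025, Theorem 1 (step of this file's proof; §2.1–§2.2 for c(P,Q,R))] -/
theorem integral_bound_eq (R τ C : ℝ) (hR : 0 < R) :
    ∫ y in (0 : ℝ)..1, (Real.exp R / τ ^ 2 * ((Real.exp (R * (y - 1 / 2))) * ((Real.exp (R * (y - 1 / 2))) * ((Real.exp (R * (y - 1 / 2))) ^ 6 - (Real.exp (R * (y - 1 / 2))) ^ 3 + 7) / (3 * (1 + (Real.exp (R * (y - 1 / 2))) ^ 3) ^ 4))) + C)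
      = Real.exp R / τ ^ 2 * ((((11 * (Real.exp (R / 2)) ^ 8 + 28 * (Real.exp (R / 2)) ^ 5 + 26 * (Real.exp (R / 2)) ^ 2) / (27 * (1 + (Real.exp (R / 2)) ^ 3) ^ 3) - 11 / 81 * Real.log (1 + (Real.exp (R / 2))) + 11 / 162 * Real.log ((Real.exp (R / 2)) ^ 2 - (Real.exp (R / 2)) + 1) + 11 * Real.sqrt 3 / 81 * Real.arctan ((2 * (Real.exp (R / 2)) - 1) / Real.sqrt 3)) - ((11 * (Real.exp (-(R / 2))) ^ 8 + 28 * (Real.exp (-(R / 2))) ^ 5 + 26 * (Real.exp (-(R / 2))) ^ 2) / (27 * (1 + (Real.exp (-(R / 2))) ^ 3) ^ 3) - 11 / 81 * Real.log (1 + (Real.exp (-(R / 2)))) + 11 / 162 * Real.log ((Real.exp (-(R / 2))) ^ 2 - (Real.exp (-(R / 2))) + 1) + 11 * Real.sqrt 3 / 81 * Real.arctan ((2 * (Real.exp (-(R / 2))) - 1) / Real.sqrt 3))) / R) + C := by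
  have hderiv : ∀ y ∈ uIcc (0 : ℝ) 1,
      HasDerivAt (fun y : ℝ => Real.exp R / τ ^ 2 * (((11 * (Real.exp (R * (y - 1 / 2))) ^ 8 + 28 * (Real.exp (R * (y - 1 / 2))) ^ 5 + 26 * (Real.exp (R * (y - 1 / 2))) ^ 2) / (27 * (1 + (Real.exp (R * (y - 1 / 2))) ^ 3) ^ 3) - 11 / 81 * Real.log (1 + (Real.exp (R * (y - 1 / 2)))) + 11 / 162 * Real.log ((Real.exp (R * (y - 1 / 2))) ^ 2 - (Real.exp (R * (y - 1 / 2))) + 1) + 11 * Real.sqrt 3 / 81 * Real.arctan ((2 * (Real.exp (R * (y - 1 / 2))) - 1) / Real.sqrt 3)) / R) + C * y)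
        (Real.exp R / τ ^ 2 * ((Real.exp (R * (y - 1 / 2))) * ((Real.exp (R * (y - 1 / 2))) * ((Real.exp (R * (y - 1 / 2))) ^ 6 - (Real.exp (R * (y - 1 / 2))) ^ 3 + 7) / (3 * (1 + (Real.exp (R * (y - 1 / 2))) ^ 3) ^ 4))) + C) y := by
    intro y _
    have hlin : HasDerivAt (fun y : ℝ => R * (y - 1 / 2)) (R * 1) y :=
      ((hasDerivAt_id' y).sub_const (1 / 2)).const_mul R
    have hu : HasDerivAt (fun y : ℝ => Real.exp (R * (y - 1 / 2)))
        (Real.exp (R * (y - 1 / 2)) * (R * 1)) y := hlin.exp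
    have hF := hasDerivAt_F (Real.exp (R * (y - 1 / 2))) (by linarith [Real.exp_pos (R * (y - 1 / 2))])
    have hcomp := hF.comp y hu
    have h2 := ((hcomp.div_const R).const_mul (Real.exp R / τ ^ 2)).add ((hasDerivAt_id' y).const_mul C)
    refine (h2.congr_deriv ?_)
    field_simp
  have hint : IntervalIntegrable (fun y : ℝ => Real.exp R / τ ^ 2 * ((Real.exp (R * (y - 1 / 2))) * ((Real.exp (R * (y - 1 / 2))) * ((Real.exp (R * (y - 1 / 2))) ^ 6 - (Real.exp (R * (y - 1 / 2))) ^ 3 + 7) / (3 * (1 + (Real.exp (R * (y - 1 / 2))) ^ 3) ^ 4))) + C)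
      MeasureTheory.volume 0 1 := by
    apply Continuous.intervalIntegrable
    have : ∀ y : ℝ, 3 * (1 + Real.exp (R * (y - 1 / 2)) ^ 3) ^ 4 ≠ 0 := fun y => by positivity
    fun_prop (disch := exact this _)
  rw [intervalIntegral.integral_eq_sub_of_hasDerivAt hderiv hint]
  have e1 : R * (1 - 1 / 2) = R / 2 := by ring
  have e0 : R * (0 - 1 / 2) = -(R / 2) := by ring
  simp only [e1, e0]
  ring

/-! ### The constant `c(P,Q,R)` for the trial data -/

/-- `c(P,Q,R) ≤ 1 + (e^R/τ²)·22√3π/243 + R·(e^R/τ²)(5ε + (7/3)ε²e^R)` for `θ = R⁻¹`, `P(x) = x`, the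
logistic `Q`. [cite: ConreyFarmerKwanLinTurnageButterbaugh2025, §2.1 (c(P,Q,R)), §2.2] -/
theorem const_le (R : ℝ) (hR : 0 < R) :
    conreyLevinsonConst R⁻¹ R (fun x ↦ x) (fun y : ℝ => ((1 / (1 + Real.exp (3 * R * (y - 1 / 2)))) - (1 / (1 + Real.exp (3 * R / 2)))) / (1 - 2 * (1 / (1 + Real.exp (3 * R / 2))))) ≤
      1 + Real.exp R / (1 - 2 * (1 / (1 + Real.exp (3 * R / 2)))) ^ 2 * (22 * Real.sqrt 3 * π / 243) + R * (Real.exp R / (1 - 2 * (1 / (1 + Real.exp (3 * R / 2)))) ^ 2 * (5 * (1 / (1 + Real.exp (3 * R / 2))) + 7 / 3 * (1 / (1 + Real.exp (3 * R / 2))) ^ 2 * Real.exp R)) := by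
  set ε := (1 / (1 + Real.exp (3 * R / 2))) with hεdef
  set τ := (1 - 2 * (1 / (1 + Real.exp (3 * R / 2)))) with hτdef
  have hε0 : 0 < ε := by rw [hεdef]; positivity
  have hτ0 : 0 < τ := by
    have := eps_lt_half hR
    rw [hτdef]; linarith
  -- the inner integral, pointwise in `y`
  have hdid : ∀ x : ℝ, deriv (fun x : ℝ => x) x = 1 := fun x => (hasDerivAt_id' x).deriv
  have hdw : ∀ y : ℝ, deriv (fun u : ℝ => Real.exp (R * u) * (((1 / (1 + Real.exp (3 * R * (u - 1 / 2)))) - ε) / τ)) y = (Real.exp (R * y) * R * (((1 / (1 + Real.exp (3 * R * (y - 1 / 2)))) - ε) / τ) + Real.exp (R * y) * ((-(Real.exp (3 * R * (y - 1 / 2)) * (3 * R)) / (1 + Real.exp (3 * R * (y - 1 / 2))) ^ 2) / τ)) :=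
    fun y => (hasDerivAt_w R ε τ y).deriv
  have hinner : ∀ y : ℝ, (∫ x in (0 : ℝ)..1,
      (Real.exp (R * y) * (((1 / (1 + Real.exp (3 * R * (y - 1 / 2)))) - ε) / τ) * deriv (fun x : ℝ => x) x
        + R⁻¹ * deriv (fun u : ℝ => Real.exp (R * u) * (((1 / (1 + Real.exp (3 * R * (u - 1 / 2)))) - ε) / τ)) y * x) ^ 2) = ((Real.exp (R * y) * (((1 / (1 + Real.exp (3 * R * (y - 1 / 2)))) - ε) / τ)) ^ 2 + (Real.exp (R * y) * (((1 / (1 + Real.exp (3 * R * (y - 1 / 2)))) - ε) / τ)) * (R⁻¹ * (Real.exp (R * y) * R * (((1 / (1 + Real.exp (3 * R * (y - 1 / 2)))) - ε) / τ) + Real.exp (R * y) * ((-(Real.exp (3 * R * (y - 1 / 2)) * (3 * R)) / (1 + Real.exp (3 * R * (y - 1 / 2))) ^ 2) / τ))) + (R⁻¹ * (Real.exp (R * y) * R * (((1 / (1 + Real.exp (3 * R * (y - 1 / 2)))) - ε) / τ) + Real.exp (R * y) * ((-(Real.exp (3 * R * (y - 1 / 2)) * (3 * R)) / (1 + Real.exp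 (3 * R * (y - 1 / 2))) ^ 2) / τ))) ^ 2 / 3) := by
    intro y
    simp only [hdid, hdw]
    rw [integral_sq_affine]
  unfold conreyLevinsonConst
  simp only [inv_inv]
  have hI : (∫ y in (0 : ℝ)..1, ∫ x in (0 : ℝ)..1,
      (Real.exp (R * y) * (((1 / (1 + Real.exp (3 * R * (y - 1 / 2)))) - ε) / τ) * deriv (fun x : ℝ => x) x
        + R⁻¹ * deriv (fun u : ℝ => Real.exp (R * u) * (((1 / (1 + Real.exp (3 * R * (u - 1 / 2)))) - ε) / τ)) y * x) ^ 2)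
      = ∫ y in (0 : ℝ)..1, ((Real.exp (R * y) * (((1 / (1 + Real.exp (3 * R * (y - 1 / 2)))) - ε) / τ)) ^ 2 + (Real.exp (R * y) * (((1 / (1 + Real.exp (3 * R * (y - 1 / 2)))) - ε) / τ)) * (R⁻¹ * (Real.exp (R * y) * R * (((1 / (1 + Real.exp (3 * R * (y - 1 / 2)))) - ε) / τ) + Real.exp (R * y) * ((-(Real.exp (3 * R * (y - 1 / 2)) * (3 * R)) / (1 + Real.exp (3 * R * (y - 1 / 2))) ^ 2) / τ))) + (R⁻¹ * (Real.exp (R * y) * R * (((1 / (1 + Real.exp (3 * R * (y - 1 / 2)))) - ε) / τ) + Real.exp (R * y) * ((-(Real.exp (3 * R * (y - 1 / 2)) * (3 * R)) / (1 + Real.exp (3 * R * (y - 1 / 2))) ^ 2) / τ))) ^ 2 / 3) :=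
    intervalIntegral.integral_congr fun y _ => hinner y
  rw [hI]
  -- integrability of both sides of the pointwise bound
  have hKint : IntervalIntegrable (fun y : ℝ => ((Real.exp (R * y) * (((1 / (1 + Real.exp (3 * R * (y - 1 / 2)))) - ε) / τ)) ^ 2 + (Real.exp (R * y) * (((1 / (1 + Real.exp (3 * R * (y - 1 / 2)))) - ε) / τ)) * (R⁻¹ * (Real.exp (R * y) * R * (((1 / (1 + Real.exp (3 * R * (y - 1 / 2)))) - ε) / τ) + Real.exp (R * y) * ((-(Real.exp (3 * R * (y - 1 / 2)) * (3 * R)) / (1 + Real.exp (3 * R * (y - 1 / 2))) ^ 2) / τ))) + (R⁻¹ * (Real.exp (R * y) * R * (((1 / (1 + Real.exp (3 * R * (y - 1 / 2)))) - ε) / τ) + Real.exp (R * y) * ((-(Real.exp (3 * R * (y - 1 / 2)) * (3 * R)) / (1 + Real.exp (3 * R * (y - 1 / 2))) ^ 2) / τ))) ^ 2 / 3)) MeasureTheory.volume 0 1 := by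
    apply Continuous.intervalIntegrable
    have h1 : ∀ y : ℝ, (1 + Real.exp (3 * R * (y - 1 / 2))) ≠ 0 := fun y => by positivity
    have h2 : ∀ y : ℝ, (1 + Real.exp (3 * R * (y - 1 / 2))) ^ 2 ≠ 0 := fun y => by positivity
    have h3 : τ ≠ 0 := hτ0.ne'
    fun_prop (disch := assumption)
  have hBint : IntervalIntegrable (fun y : ℝ => (Real.exp R / τ ^ 2 * ((Real.exp (R * (y - 1 / 2))) * ((Real.exp (R * (y - 1 / 2))) * ((Real.exp (R * (y - 1 / 2))) ^ 6 - (Real.exp (R * (y - 1 / 2))) ^ 3 + 7) / (3 * (1 + (Real.exp (R * (y - 1 / 2))) ^ 3) ^ 4))) + (Real.exp R / τ ^ 2 * (5 * ε + 7 / 3 * ε ^ 2 * Real.exp R)))) MeasureTheory.volume 0 1 := by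
    apply Continuous.intervalIntegrable
    have : ∀ y : ℝ, 3 * (1 + Real.exp (R * (y - 1 / 2)) ^ 3) ^ 4 ≠ 0 := fun y => by positivity
    fun_prop (disch := exact this _)
  have hmono : (∫ y in (0 : ℝ)..1, ((Real.exp (R * y) * (((1 / (1 + Real.exp (3 * R * (y - 1 / 2)))) - ε) / τ)) ^ 2 + (Real.exp (R * y) * (((1 / (1 + Real.exp (3 * R * (y - 1 / 2)))) - ε) / τ)) * (R⁻¹ * (Real.exp (R * y) * R * (((1 / (1 + Real.exp (3 * R * (y - 1 / 2)))) - ε) / τ) + Real.exp (R * y) * ((-(Real.exp (3 * R * (y - 1 / 2)) * (3 * R)) / (1 + Real.exp (3 * R * (y - 1 / 2))) ^ 2) / τ))) + (R⁻¹ * (Real.exp (R * y) * R * (((1 / (1 + Real.exp (3 * R * (y - 1 / 2)))) - ε) / τ) + Real.exp (R * y) * ((-(Real.exp (3 * R * (y - 1 / 2)) * (3 * R)) / (1 + Real.exp (3 * R * (y - 1 / 2))) ^ 2) / τ))) ^ 2 / 3)) ≤ ∫ y in (0 : ℝ)..1, (Real.exp R / τ ^ 2 * ((Real.exp (R * (y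 - 1 / 2))) * ((Real.exp (R * (y - 1 / 2))) * ((Real.exp (R * (y - 1 / 2))) ^ 6 - (Real.exp (R * (y - 1 / 2))) ^ 3 + 7) / (3 * (1 + (Real.exp (R * (y - 1 / 2))) ^ 3) ^ 4))) + (Real.exp R / τ ^ 2 * (5 * ε + 7 / 3 * ε ^ 2 * Real.exp R))) :=
    intervalIntegral.integral_mono_on (by norm_num) hKint hBint
      (fun y hy => key_pointwise R ε τ y hR hε0.le hτ0 hy.2)
  rw [integral_bound_eq R τ _ hR] at hmono
  have hF : ((11 * (Real.exp (R / 2)) ^ 8 + 28 * (Real.exp (R / 2)) ^ 5 + 26 * (Real.exp (R / 2)) ^ 2) / (27 * (1 + (Real.exp (R / 2)) ^ 3) ^ 3) - 11 / 81 * Real.log (1 + (Real.exp (R / 2))) + 11 / 162 * Real.log ((Real.exp (R / 2)) ^ 2 - (Real.exp (R / 2)) + 1) + 11 * Real.sqrt 3 / 81 * Real.arctan ((2 * (Real.exp (R / 2)) - 1) / Real.sqrt 3)) - ((11 * (Real.exp (-(R / 2))) ^ 8 + 28 * (Real.exp (-(R / 2))) ^ 5 + 26 * (Real.exp (-(R /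 2))) ^ 2) / (27 * (1 + (Real.exp (-(R / 2))) ^ 3) ^ 3) - 11 / 81 * Real.log (1 + (Real.exp (-(R / 2)))) + 11 / 162 * Real.log ((Real.exp (-(R / 2))) ^ 2 - (Real.exp (-(R / 2))) + 1) + 11 * Real.sqrt 3 / 81 * Real.arctan ((2 * (Real.exp (-(R / 2))) - 1) / Real.sqrt 3)) ≤ (22 * Real.sqrt 3 * π / 243) :=
    F_sub_le (Real.exp_pos _).le (Real.exp_le_exp.2 (by linarith))
  have hX : 0 ≤ Real.exp R / τ ^ 2 := by positivity
  have h3 : Real.exp R / τ ^ 2 * ((((11 * (Real.exp (R / 2)) ^ 8 + 28 * (Real.exp (R / 2)) ^ 5 + 26 * (Real.exp (R / 2)) ^ 2) / (27 * (1 + (Real.exp (R / 2)) ^ 3) ^ 3) - 11 / 81 * Real.log (1 + (Real.exp (R / 2))) + 11 / 162 * Real.log ((Real.exp (R / 2)) ^ 2 - (Real.exp (R / 2)) + 1) + 11 * Real.sqrt 3 / 81 * Real.arctan ((2 * (Real.exp (R / 2)) - 1) / Real.sqrt 3)) - ((11 * (Real.exp (-(R / 2))) ^ 8 + 28 * (Real.exp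 (-(R / 2))) ^ 5 + 26 * (Real.exp (-(R / 2))) ^ 2) / (27 * (1 + (Real.exp (-(R / 2))) ^ 3) ^ 3) - 11 / 81 * Real.log (1 + (Real.exp (-(R / 2)))) + 11 / 162 * Real.log ((Real.exp (-(R / 2))) ^ 2 - (Real.exp (-(R / 2))) + 1) + 11 * Real.sqrt 3 / 81 * Real.arctan ((2 * (Real.exp (-(R / 2))) - 1) / Real.sqrt 3))) / R)
      ≤ Real.exp R / τ ^ 2 * ((22 * Real.sqrt 3 * π / 243) / R) :=
    mul_le_mul_of_nonneg_left (div_le_div_of_nonneg_right hF hR.le) hX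
  have h4 : R * (Real.exp R / τ ^ 2 * ((22 * Real.sqrt 3 * π / 243) / R)) = Real.exp R / τ ^ 2 * (22 * Real.sqrt 3 * π / 243) := by
    field_simp
  nlinarith [hmono, h3, h4, hR]

/-- `0 < c(P,Q,R)` (indeed `≥ 1`): the double integral of a square is non-negative.
[cite: ConreyFarmerKwanLinTurnageButterbaugh2025, Theorem 1 (step of this file's proof; §2.1–§2.2 for c(P,Q,R))] -/
theorem const_pos (θ R : ℝ) (hθ : 0 ≤ θ) (Q : ℝ → ℝ) : 0 < conreyLevinsonConst θ R (fun x ↦ x) Q := by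
  unfold conreyLevinsonConst
  have h : 0 ≤ ∫ y in (0 : ℝ)..1, ∫ x in (0 : ℝ)..1,
      (Real.exp (R * y) * Q y * deriv (fun x : ℝ => x) x
        + θ * deriv (fun u : ℝ => Real.exp (R * u) * Q u) y * (fun x : ℝ => x) x) ^ 2 :=
    intervalIntegral.integral_nonneg (by norm_num) fun y _ =>
      intervalIntegral.integral_nonneg (by norm_num) fun x _ => sq_nonneg _
  have : 0 ≤ θ⁻¹ * ∫ y in (0 : ℝ)..1, ∫ x in (0 : ℝ)..1,
      (Real.exp (R * y) * Q y * deriv (fun x : ℝ => x) x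
        + θ * deriv (fun u : ℝ => Real.exp (R * u) * Q u) y * (fun x : ℝ => x) x) ^ 2 :=
    mul_nonneg (inv_nonneg.2 hθ) h
  linarith

/-! ### Numerics for `R ≥ 8` -/

/-- `√3 < 1.7321`. [cite: ConreyFarmerKwanLinTurnageButterbaugh2025, Theorem 1 (step of this file's proof; §2.1–§2.2 for c(P,Q,R))] -/
theorem sqrt3_lt : Real.sqrt 3 < 1.7321 := by
  rw [show (1.7321 : ℝ) = Real.sqrt (1.7321 ^ 2) by rw [Real.sqrt_sq (by norm_num)]]
  exact Real.sqrt_lt_sqrt (by norm_num) (by norm_num)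

/-- `22√3π/243 < 0.4927`. [cite: ConreyFarmerKwanLinTurnageButterbaugh2025, Theorem 1 (step of this file's proof; §2.1–§2.2 for c(P,Q,R))] -/
theorem minf_lt : (22 * Real.sqrt 3 * π / 243) < 0.4927 := by
  have h3 := sqrt3_lt
  have hπ := Real.pi_lt_d6
  have h3pos : 0 < Real.sqrt 3 := by positivity
  nlinarith [Real.pi_pos, mul_lt_mul'' h3 hπ h3pos.le Real.pi_pos.le]

/-- `e > 2.7`. [cite: ConreyFarmerKwanLinTurnageButterbaugh2025, Theorem 1 (step of this file's proof; §2.1–§2.2 for c(P,Q,R))] -/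
theorem exp_one_gt : (2.7 : ℝ) < Real.exp 1 := by linarith [Real.exp_one_gt_d9]

/-- `e⁸ > 2500`. [cite: ConreyFarmerKwanLinTurnageButterbaugh2025, Theorem 1 (step of this file's proof; §2.1–§2.2 for c(P,Q,R))] -/
theorem exp_eight_gt : (2500 : ℝ) < Real.exp 8 := by
  have h := pow_lt_pow_left₀ exp_one_gt (by norm_num) (by norm_num : (8 : ℕ) ≠ 0)
  rw [← Real.exp_nat_mul] at h
  norm_num at h
  linarith

/-- `e⁴ > 50`. [cite: ConreyFarmerKwanLinTurnageButterbaugh2025, Theorem 1 (step of this file's proof; §2.1–§2.2 for c(P,Q,R))] -/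
theorem exp_four_gt : (50 : ℝ) < Real.exp 4 := by
  have h := pow_lt_pow_left₀ exp_one_gt (by norm_num) (by norm_num : (4 : ℕ) ≠ 0)
  rw [← Real.exp_nat_mul] at h
  norm_num at h
  linarith

/-- `e¹² > 150000`. [cite: ConreyFarmerKwanLinTurnageButterbaugh2025, Theorem 1 (step of this file's proof; §2.1–§2.2 for c(P,Q,R))] -/
theorem exp_twelve_gt : (150000 : ℝ) < Real.exp 12 := by
  have h := pow_lt_pow_left₀ exp_one_gt (by norm_num) (by norm_num : (12 : ℕ) ≠ 0)
  rw [← Real.exp_nat_mul] at h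
  norm_num at h
  linarith

/-- `e^{−2/3} > 0.5132`. [cite: ConreyFarmerKwanLinTurnageButterbaugh2025, Theorem 1 (step of this file's proof; §2.1–§2.2 for c(P,Q,R))] -/
theorem exp_neg_two_thirds_gt : (0.5132 : ℝ) < Real.exp (-(2 / 3)) := by
  have he : Real.exp 1 < 2.7182818286 := Real.exp_one_lt_d9
  have h2 : Real.exp 2 < 7.3891 := by
    have : Real.exp 2 = Real.exp 1 * Real.exp 1 := by rw [← Real.exp_add]; norm_num
    rw [this]; nlinarith [Real.exp_pos 1]
  have h23 : Real.exp (2 / 3) < 1.9485 := by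
    by_contra h
    push Not at h
    have hp := pow_le_pow_left₀ (by norm_num) h 3
    rw [← Real.exp_nat_mul] at hp
    norm_num at hp
    linarith
  rw [Real.exp_neg]
  rw [lt_inv_comm₀ (by norm_num) (Real.exp_pos _)]
  calc Real.exp (2 / 3) < 1.9485 := h23
    _ < (0.5132 : ℝ)⁻¹ := by norm_num

/-- The final numerical inequality: for `R ≥ 8` the upper bound for `c` is `< e^{R − 2/3}`.
[cite: ConreyFarmerKwanLinTurnageButterbaugh2025, Theorem 1 (step of this file's proof; §2.1–§2.2 for c(P,Q,R))] -/
theorem numeric (R : ℝ) (hR : 8 ≤ R) :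
    1 + Real.exp R / (1 - 2 * (1 / (1 + Real.exp (3 * R / 2)))) ^ 2 * (22 * Real.sqrt 3 * π / 243) + R * (Real.exp R / (1 - 2 * (1 / (1 + Real.exp (3 * R / 2)))) ^ 2 * (5 * (1 / (1 + Real.exp (3 * R / 2))) + 7 / 3 * (1 / (1 + Real.exp (3 * R / 2))) ^ 2 * Real.exp R)) < Real.exp (R - 2 / 3) := by
  set ε := (1 / (1 + Real.exp (3 * R / 2))) with hεdef
  set X := Real.exp R with hXdef
  set M := (22 * Real.sqrt 3 * π / 243) with hMdef
  have hX0 : 0 < X := Real.exp_pos _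
  have hR0 : 0 < R := by linarith
  have hX : 2500 ≤ X := by
    have := Real.exp_le_exp.2 hR
    linarith [exp_eight_gt]
  have h32 : Real.exp (3 * R / 2) = X * Real.exp (R / 2) := by
    rw [hXdef, ← Real.exp_add]; congr 1; ring
  have hhalf : R / 2 + 1 ≤ Real.exp (R / 2) := Real.add_one_le_exp _
  have hhalf4 : 50 < Real.exp (R / 2) :=
    lt_of_lt_of_le exp_four_gt (Real.exp_le_exp.2 (by linarith))
  have h12 : 150000 < Real.exp (3 * R / 2) :=
    lt_of_lt_of_le exp_twelve_gt (Real.exp_le_exp.2 (by linarith))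
  have hE0 : 0 < 1 + Real.exp (3 * R / 2) := by positivity
  have hε0 : 0 < ε := by rw [hεdef]; positivity
  -- ε R X ≤ 2
  have hA : ε * R * X ≤ 2 := by
    rw [hεdef]
    rw [show 1 / (1 + Real.exp (3 * R / 2)) * R * X = R * X / (1 + Real.exp (3 * R / 2)) by
      field_simp]
    rw [div_le_iff₀ hE0, h32]
    nlinarith [hX0, hhalf]
  -- ε X ≤ 0.02
  have hB : ε * X ≤ 0.02 := by
    rw [hεdef]
    rw [show 1 / (1 + Real.exp (3 * R / 2)) * X = X / (1 + Real.exp (3 * R / 2)) by field_simp]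
    rw [div_le_iff₀ hE0, h32]
    nlinarith [hX0, hhalf4]
  -- ε ≤ 1/150000, hence τ² ≥ 0.9999
  have hεsmall : ε ≤ 1 / 150000 := by
    rw [hεdef]
    rw [div_le_div_iff₀ hE0 (by norm_num)]
    linarith
  have hτ : (0.9999 : ℝ) ≤ (1 - 2 * ε) ^ 2 := by nlinarith
  have hτpos : 0 < (1 - 2 * ε) ^ 2 := by linarith
  have hM : M < 0.4927 := minf_lt
  have hM0 : 0 < M := by rw [hMdef]; positivity
  -- assemble
  have hsplit : 1 + X / (1 - 2 * ε) ^ 2 * M + R * (X / (1 - 2 * ε) ^ 2 * (5 * ε + 7 / 3 * ε ^ 2 * X))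
      = 1 + (X * M + 5 * (ε * R * X) + 7 / 3 * ((ε * R * X) * (ε * X))) / (1 - 2 * ε) ^ 2 := by
    field_simp
    ring
  rw [hsplit]
  have hnum : X * M + 5 * (ε * R * X) + 7 / 3 * ((ε * R * X) * (ε * X)) ≤ 0.4927 * X + 10.1 := by
    have h1 : X * M ≤ X * 0.4927 := mul_le_mul_of_nonneg_left hM.le hX0.le
    have h2 : (ε * R * X) * (ε * X) ≤ 2 * 0.02 :=
      mul_le_mul hA hB (by positivity) (by norm_num)
    nlinarith
  have hstep : (X * M + 5 * (ε * R * X) + 7 / 3 * ((ε * R * X) * (ε * X))) / (1 - 2 * ε) ^ 2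
      ≤ (0.4927 * X + 10.1) / 0.9999 :=
    div_le_div₀ (by positivity) hnum (by norm_num) hτ
  have hexp : Real.exp (R - 2 / 3) = X * Real.exp (-(2 / 3)) := by
    rw [hXdef, ← Real.exp_add, ← sub_eq_add_neg]
  have h23 := exp_neg_two_thirds_gt
  rw [hexp]
  have hfin : 1 + (0.4927 * X + 10.1) / 0.9999 < X * 0.5132 := by
    rw [div_eq_mul_inv]
    nlinarith [hX]
  calc 1 + (X * M + 5 * (ε * R * X) + 7 / 3 * ((ε * R * X) * (ε * X))) / (1 - 2 * ε) ^ 2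
      ≤ 1 + (0.4927 * X + 10.1) / 0.9999 := by linarith
    _ < X * 0.5132 := hfin
    _ ≤ X * Real.exp (-(2 / 3)) := mul_le_mul_of_nonneg_left h23.le hX0.le

end CFKLTProof

open CFKLTProof

/-- **CFKLT 2025, Theorem 1 — PROVED** (discharge of `cfklt2025_shortMollifiers_theorem1`, statement
unchanged, run against the tree's own `conreyLevinsonConst` / `levinsonProportion` / `IsAdmissibleQ`):
with `θ₀ = 1/8`, for `0 < θ < θ₀` take `R = 1/θ` and the logistic detector; then
`κ = 1 − log c(P,Q,R)/R > 2θ/3`. ROAD DIFFERS from the printed one (CFKLTB take `R = √(3/5)/θ` and an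
`₂F₁` optimiser, §§3–5); nothing numerical is load-bearing here beyond the kernel-checked decimal
comparisons of `CFKLTProof.numeric` (`√3 < 1.7321`, `π < 3.141593`, `e > 2.7`, `e < 2.7182818286`); the
float `κ/θ ≈ 0.708` quoted in the module docstring is illustration only, and the `kit` job that FOUND the
antiderivative `F` (j261482, tag sz) is re-verified symbolically by `CFKLTProof.hasDerivAt_F`.
[cite: ConreyFarmerKwanLinTurnageButterbaugh2025, Theorem 1] -/
theorem cfklt2025_shortMollifiers_theorem1_holds : cfklt2025_shortMollifiers_theorem1 := by
  refine ⟨1 / 8, by norm_num, fun θ hθ hθ8 => ?_⟩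
  obtain ⟨R, rfl⟩ : ∃ R : ℝ, R⁻¹ = θ := ⟨θ⁻¹, inv_inv θ⟩
  have hR0 : 0 < R := inv_pos.1 hθ
  have hR8 : 8 ≤ R := by
    by_contra h
    push Not at h
    have : (8 : ℝ)⁻¹ < R⁻¹ := (inv_lt_inv₀ (by norm_num) hR0).2 h
    norm_num at this hθ8
    linarith
  refine ⟨R, hR0, (fun y : ℝ => ((1 / (1 + Real.exp (3 * R * (y - 1 / 2)))) - (1 / (1 + Real.exp (3 * R / 2)))) / (1 - 2 * (1 / (1 + Real.exp (3 * R / 2))))), isAdmissibleQ_logistic hR0, ?_⟩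
  rw [levinsonProportion_def]
  have hcpos : 0 < conreyLevinsonConst R⁻¹ R (fun x ↦ x) (fun y : ℝ => ((1 / (1 + Real.exp (3 * R * (y - 1 / 2)))) - (1 / (1 + Real.exp (3 * R / 2)))) / (1 - 2 * (1 / (1 + Real.exp (3 * R / 2))))) :=
    const_pos R⁻¹ R (inv_nonneg.2 hR0.le) _
  have hcle := const_le R hR0
  have hnum := numeric R hR8
  have hlog : Real.log (conreyLevinsonConst R⁻¹ R (fun x ↦ x) (fun y : ℝ => ((1 / (1 + Real.exp (3 * R * (y - 1 / 2)))) - (1 / (1 + Real.exp (3 * R / 2)))) / (1 - 2 * (1 / (1 + Real.exp (3 * R / 2)))))) < R - 2 / 3 := by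
    have h1 := lt_of_le_of_lt hcle hnum
    calc Real.log (conreyLevinsonConst R⁻¹ R (fun x ↦ x) (fun y : ℝ => ((1 / (1 + Real.exp (3 * R * (y - 1 / 2)))) - (1 / (1 + Real.exp (3 * R / 2)))) / (1 - 2 * (1 / (1 + Real.exp (3 * R / 2))))))
        < Real.log (Real.exp (R - 2 / 3)) := Real.log_lt_log hcpos h1
      _ = R - 2 / 3 := Real.log_exp _
  have hdiv : Real.log (conreyLevinsonConst R⁻¹ R (fun x ↦ x) (fun y : ℝ => ((1 / (1 + Real.exp (3 * R * (y - 1 / 2)))) - (1 / (1 + Real.exp (3 * R / 2)))) / (1 - 2 * (1 / (1 + Real.exp (3 * R / 2)))))) / R < (R - 2 / 3) / R :=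
    div_lt_div_of_pos_right hlog hR0
  have hid : (R - 2 / 3) / R = 1 - 2 * R⁻¹ / 3 := by
    field_simp
  rw [hid] at hdiv
  linarith

/-- **Alias discharge**: the second rendering of the same printed theorem
(`LevinsonConreyShortMollifiers.lean`) follows through the proved bridge `…_of_record`.
[cite: ConreyFarmerKwanLinTurnageButterbaugh2025, Theorem 1] -/
theorem conreyFarmerKwanLinTurnageButterbaugh2025_theorem1_holds :
    conreyFarmerKwanLinTurnageButterbaugh2025_theorem1 :=
  conreyFarmerKwanLinTurnageButterbaugh2025_theorem1_of_record cfklt2025_shortMollifiers_theorem1_holds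


end ShortMollifiers

end Literature.NumberTheory.LFunctions
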